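import Mathlib
import HarnessLib
import Literature.Analysis.FluidPDE.CurlFreeLiouville
import Summits.NavierStokesRegularity.NavierStokesRegularity.Theorems.UnthreadedDoorAntidynamoWallOneInstantFrame
import Summits.NavierStokesRegularity.NavierStokesRegularity.Theorems.UnthreadedDoorCellFluxForwardVanishing
import Summits.NavierStokesRegularity.NavierStokesRegularity.Theorems.StableStrataDoorOneSliceAxiPropagation
import Summits.NavierStokesRegularity.NavierStokesRegularity.Theorems.TypeILiouvilleTypeIliouvilleLOseenGauge

/-!
# Route `UnthreadedDoor` / `ThreadingFlux`, crux `PoloidalLiouville` (stmt-NavierStokesRegularity-1222), antidynamo v2 skeleton (sha16 `4ebf5683127b`),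
# WALL `stub_scalarLiouville`: ★★★ ONE-SLICE RIGIDITY OF THE DUALITY CLASS MODULO GALILEAN DRIFT

Support file (seat leafhand-ns-unthreadeddoor-2 g2, cell decomp-ns), `--supports stmt-NavierStokesRegularity-1222 --as helper`; theorems only.

The structural fact behind every «one instant» closer of the wall, stated once for the whole class and WITHOUT any unthreadedness hypothesis:

* ★★★ `exists_drift_of_slice_eq_add_const` — **TWO bounded ancient mild solutions (`ν = 1`, the tree's duality class) with measurable slices, jointly
  continuous on `(−∞,0) × ℝ³`, whose slices at ONE instant `t₁ < 0` differ by a constant vector, differ at EVERY instant `t < 0` by a Galilean drift: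
  `u(t, x) = v(t, x − γ(t)) + κ(t)`.**  [Oseen gauges of both (`Theorems.oseen_gauge_of_aestronglyMeasurable`); at `t₁` the two bounded Oseen-ancient
  representatives differ by a translation and a constant; the constant Galilean boost of the translated representative (`OneInstant.oseenAncient_boost`,
  i.e. `Theorems.stub_oseen_const_boost`) has the same slice at `t₁` as the other representative, so the two coincide at every `t < 0` by ONE-SLICE
  UNIQUENESS in the bounded Oseen-ancient class (`eq_of_eq_slice`: bounded Oseen-mild uniqueness forward, real-analyticity in time backward).]
* ★★★ `exists_drift_curl_of_curl_slice_eq` — **THE VORTICITY AT ONE INSTANT DETERMINES THE VORTICITY AT EVERY INSTANT UP TO A TRANSLATION PATH**: two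
  jointly smooth members of the class with the same vorticity at ONE `t₁ < 0` have `curl u(t, x) = curl v(t, x − γ(t))` for all `t < 0` (their slices at
  `t₁` are bounded, divergence free with the same curl, hence differ by a constant — KNSS Lemma 3.1).
* `curl_translate_of_slice_eq_add_const` — the same conclusion from slices differing by a constant.

MEANING FOR THE WALL: `StubScalarLiouville` is a statement about ONE SLICE — the flow (hence its unthreadedness at all other times) is a functional of any
single vorticity slice modulo a translation path; every symmetry / degeneracy test may be run at a single instant (files `…WallOneInstantZonal`,
`…WallOneInstantSymmetry`, `…WallOneInstantAxisymmetric`).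

HONEST LABEL: assembly over landed theorems (Oseen gauge p-TypeIliouvilleL, constant boost, one-slice uniqueness); nothing here proves
`stub_scalarLiouville`, `PoloidalLiouville` (1222), or bears on Navier–Stokes regularity; no summit statement is proved (crux 1222 is INCOMPARABLE with
the summit). [folklore] [cite: KochNadirashviliSereginSverak2009, Lemma 3.1 and §4 (4.3)–(4.4) (arXiv:0709.3599 pp. 6–8); LemarieRieusset2016, Thm. 9.12;
MajdaBertozziCUP2002, §1.2]
-/

noncomputable section

-- the summit and its single sub-problem share the name (CONVENTIONS §1)
set_option linter.dupNamespace false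

open scoped Topology InnerProductSpace RealInnerProductSpace ContDiff
open Filter Set Function Metric MeasureTheory
open Literature.Analysis Literature.Analysis.FluidPDE

namespace Summit.NavierStokesRegularity.NavierStokesRegularity.Theorems.PoloidalLiouville.Antidynamo

open Summit.NavierStokesRegularity.NavierStokesRegularity.Theorems.PoloidalLiouville.NetFlux (E3)
open Summit.NavierStokesRegularity.NavierStokesRegularity.Theorems.StableStrataDoorOneSliceAxiPropagation (eq_of_eq_slice)

namespace OneInstant

/-! ### ★★★ One-slice rigidity modulo Galilean drift -/

/-- ★★★ **ONE-SLICE RIGIDITY OF THE DUALITY CLASS MODULO GALILEAN DRIFT.**  Let `u`, `v` be bounded ancient mild solutions (`ν = 1`, duality class) with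
measurable slices, jointly continuous on `(−∞,0) × ℝ³`.  If `u(t₁) = v(t₁) + k` for ONE `t₁ < 0` and ONE constant vector `k`, then there are paths
`γ, κ : ℝ → ℝ³` with `u(t, x) = v(t, x − γ(t)) + κ(t)` for ALL `t < 0` and `x` (module docstring for the proof).
[cite: KochNadirashviliSereginSverak2009, §1 p. 3 and §4 (4.3)–(4.4) (arXiv:0709.3599 pp. 3, 8); LemarieRieusset2016, Thm. 9.12; MajdaBertozziCUP2002, §1.2] -/
theorem exists_drift_of_slice_eq_add_const
    (u v : ℝ → EuclideanSpace ℝ (Fin 3) → EuclideanSpace ℝ (Fin 3))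
    (huB : Literature.Analysis.FluidPDE.IsBoundedAncientMildSolution 1 u)
    (hum : ∀ t < 0, AEStronglyMeasurable (u t) volume)
    (huc : ContinuousOn (Function.uncurry u) (Set.Iio 0 ×ˢ Set.univ))
    (hvB : Literature.Analysis.FluidPDE.IsBoundedAncientMildSolution 1 v)
    (hvm : ∀ t < 0, AEStronglyMeasurable (v t) volume)
    (hvc : ContinuousOn (Function.uncurry v) (Set.Iio 0 ×ˢ Set.univ))
    {t₁ : ℝ} (ht₁ : t₁ < 0) {k : EuclideanSpace ℝ (Fin 3)} (h₁ : ∀ x, u t₁ x = v t₁ x + k) :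
    ∃ γ κ : ℝ → EuclideanSpace ℝ (Fin 3), ∀ t < 0, ∀ x, u t x = v t (x - γ t) + κ t := by
  -- ## the two Oseen gauges, everywhere
  obtain ⟨wu, Au, cu, -, hwuc, hwub, -, hwum, -, hrepu⟩ := Theorems.oseen_gauge_of_aestronglyMeasurable u huB hum
  obtain ⟨wv, Av, cv, -, hwvc, hwvb, hwvdiv, hwvm, -, hrepv⟩ := Theorems.oseen_gauge_of_aestronglyMeasurable v hvB hvm
  have hrepu' : ∀ s < 0, ∀ y, u s y = wu s (y - Au s) + cu s :=
    fun s hs y => CellFlux.galilean_rep_everywhere huc hwuc hrepu hs y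
  have hrepv' : ∀ s < 0, ∀ y, v s y = wv s (y - Av s) + cv s :=
    fun s hs y => CellFlux.galilean_rep_everywhere hvc hwvc hrepv hs y
  -- ## at `t₁` the representatives differ by a translation `a` and a constant `k'`
  set a : E3 := Au t₁ - Av t₁ with ha
  set k' : E3 := cv t₁ + k - cu t₁ with hk'
  have hslice : ∀ y, wu t₁ y = wv t₁ (y + a) + k' := fun y => by
    have h := hrepu' t₁ ht₁ (y + Au t₁)
    rw [add_sub_cancel_right, h₁, hrepv' t₁ ht₁] at h
    -- `h : wv t₁ (y + Au t₁ - Av t₁) + cv t₁ + k = wu t₁ y + cu t₁`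
    have e1 : y + Au t₁ - Av t₁ = y + a := by rw [ha]; abel
    rw [e1] at h
    rw [hk', ← add_sub_assoc, eq_sub_iff_add_eq, ← h, add_assoc]
  -- ## the boosted-and-translated representative of `v` has the slice `wu t₁` at `t₁`
  obtain ⟨hcb, hbb, hmb⟩ := oseenAncient_boost hwvc hwvb hwvdiv hwvm (-k') t₁
  obtain ⟨hcW, hbW, hmW⟩ := oseenAncient_translate hcb hbb hmb a
  set W : ℝ → E3 → E3 := fun t y => (fun t y => wv t (y + (t - t₁) • (-k')) - -k') t (y + a) with hW
  have hW₁ : wu t₁ = W t₁ := by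
    funext y
    simp only [hW, sub_self, zero_smul, add_zero, sub_neg_eq_add]
    exact hslice y
  -- ## one-slice uniqueness in the bounded Oseen-ancient class
  have hbdd : ∀ {f : ℝ → E3 → E3}, (∃ K : ℝ, ∀ t < 0, ∀ y, ‖f t y‖ ≤ K) →
      ∀ δ : ℝ, 0 < δ → ∃ B : ℝ, ∀ t < -δ, ∀ y : E3, ‖f t y‖ ≤ B := fun ⟨K, hK⟩ δ hδ =>
    ⟨K, fun t ht y => hK t (by linarith) y⟩
  have heq : ∀ t < 0, wu t = W t := eq_of_eq_slice hwuc (hbdd hwub) hwum hcW (hbdd hbW) hmW ht₁ hW₁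
  -- ## undo the gauges
  refine ⟨fun t => Au t - a - (t - t₁) • (-k') - Av t, fun t => cu t - cv t - (-k'), fun t ht x => ?_⟩
  rw [hrepu' t ht x, heq t ht, hrepv' t ht]
  simp only [hW]
  have e2 : x - (Au t - a - (t - t₁) • -k' - Av t) - Av t = x - Au t + a + (t - t₁) • -k' := by abel
  rw [e2]
  abel

/-! ### ★★★ The vorticity at one instant determines the vorticity at every instant, up to a translation path -/

/-- The curl of a Galilean image: `curl (x ↦ g(x − γ) + κ)(x) = (curl g)(x − γ)`. [folklore] -/
theorem curl_comp_sub_add_const (g : EuclideanSpace ℝ (Fin 3) → EuclideanSpace ℝ (Fin 3)) (γ κ x : EuclideanSpace ℝ (Fin 3)) :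
    curl (fun y => g (y - γ) + κ) x = curl g (x - γ) := by
  have e : (fun y => g (y - γ) + κ) = fun y => g (y + -γ) - -κ := by
    funext y
    simp [sub_eq_add_neg]
  rw [e, CellFlux.curl_comp_add_sub_const, ← sub_eq_add_neg]

/-- ★★★ **SLICES DIFFERING BY A CONSTANT ⇒ VORTICITIES TRANSLATES OF EACH OTHER AT EVERY TIME.** [cite: KochNadirashviliSereginSverak2009, §4 (arXiv:0709.3599 p. 8); MajdaBertozziCUP2002, §1.2] -/
theorem curl_translate_of_slice_eq_add_const
    (u v : ℝ → EuclideanSpace ℝ (Fin 3) → EuclideanSpace ℝ (Fin 3))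
    (huB : Literature.Analysis.FluidPDE.IsBoundedAncientMildSolution 1 u)
    (hum : ∀ t < 0, AEStronglyMeasurable (u t) volume)
    (huc : ContinuousOn (Function.uncurry u) (Set.Iio 0 ×ˢ Set.univ))
    (hvB : Literature.Analysis.FluidPDE.IsBoundedAncientMildSolution 1 v)
    (hvm : ∀ t < 0, AEStronglyMeasurable (v t) volume)
    (hvc : ContinuousOn (Function.uncurry v) (Set.Iio 0 ×ˢ Set.univ))
    {t₁ : ℝ} (ht₁ : t₁ < 0) {k : EuclideanSpace ℝ (Fin 3)} (h₁ : ∀ x, u t₁ x = v t₁ x + k) :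
    ∃ γ : ℝ → EuclideanSpace ℝ (Fin 3), ∀ t < 0, ∀ x, curl (u t) x = curl (v t) (x - γ t) := by
  obtain ⟨γ, κ, h⟩ := exists_drift_of_slice_eq_add_const u v huB hum huc hvB hvm hvc ht₁ h₁
  refine ⟨γ, fun t ht x => ?_⟩
  have e : u t = fun y => v t (y - γ t) + κ t := funext (h t ht)
  rw [e, curl_comp_sub_add_const]

/-- ★★★ **THE VORTICITY AT ONE INSTANT DETERMINES THE VORTICITY AT EVERY INSTANT, UP TO A TRANSLATION PATH.**  Two bounded ancient mild solutions
(`ν = 1`, duality class) with measurable slices, jointly smooth on `(−∞,0) × ℝ³`, with the SAME vorticity at ONE `t₁ < 0`, have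
`curl u(t, x) = curl v(t, x − γ(t))` for every `t < 0` (their slices at `t₁` are smooth, bounded, divergence free with the same curl, hence differ by a
constant — KNSS 2009 Lemma 3.1, tree `eq_of_curl_eq_zero_of_isDivFree_of_bounded` — and `curl_translate_of_slice_eq_add_const` applies).
[cite: KochNadirashviliSereginSverak2009, Lemma 3.1 and §4 (arXiv:0709.3599 pp. 6–8); LemarieRieusset2016, Thm. 9.12; MajdaBertozziCUP2002, §1.2] -/
theorem exists_drift_curl_of_curl_slice_eq
    (u v : ℝ → EuclideanSpace ℝ (Fin 3) → EuclideanSpace ℝ (Fin 3))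
    (huB : Literature.Analysis.FluidPDE.IsBoundedAncientMildSolution 1 u)
    (hum : ∀ t < 0, AEStronglyMeasurable (u t) volume)
    (husm : ContDiffOn ℝ (⊤ : ℕ∞) (Function.uncurry u) (Set.Iio 0 ×ˢ Set.univ))
    (hvB : Literature.Analysis.FluidPDE.IsBoundedAncientMildSolution 1 v)
    (hvm : ∀ t < 0, AEStronglyMeasurable (v t) volume)
    (hvsm : ContDiffOn ℝ (⊤ : ℕ∞) (Function.uncurry v) (Set.Iio 0 ×ˢ Set.univ))
    {t₁ : ℝ} (ht₁ : t₁ < 0) (h₁ : ∀ x, curl (u t₁) x = curl (v t₁) x) :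
    ∃ γ : ℝ → EuclideanSpace ℝ (Fin 3), ∀ t < 0, ∀ x, curl (u t) x = curl (v t) (x - γ t) := by
  have husm' : IsSmoothSpaceTimeOn (Iio 0) u := husm
  have hvsm' : IsSmoothSpaceTimeOn (Iio 0) v := hvsm
  -- the difference of the slices at `t₁` is smooth, bounded, divergence free and curl free, hence constant
  have hu1 : ContDiff ℝ (⊤ : ℕ∞) (u t₁) := husm'.contDiff_slice ht₁
  have hv1 : ContDiff ℝ (⊤ : ℕ∞) (v t₁) := hvsm'.contDiff_slice ht₁
  have hd2 : ContDiff ℝ 2 (fun x => u t₁ x - v t₁ x) := (hu1.sub hv1).of_le (by norm_cast)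
  have hud : Differentiable ℝ (u t₁) := hu1.differentiable (by simp)
  have hvd : Differentiable ℝ (v t₁) := hv1.differentiable (by simp)
  have hcurl : ∀ x, curl (fun x => u t₁ x - v t₁ x) x = 0 := fun x => by
    rw [curl_sub (hud x) (hvd x), h₁ x, sub_self]
  have hdivu : VectorCalculus.IsDivFree (u t₁) :=
    (huB.isAncientMildSolution.1 t₁ ht₁).isDivFree_of_contDiff (hu1.of_le (by norm_cast))
  have hdivv : VectorCalculus.IsDivFree (v t₁) :=
    (hvB.isAncientMildSolution.1 t₁ ht₁).isDivFree_of_contDiff (hv1.of_le (by norm_cast))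
  have hdiv : VectorCalculus.IsDivFree (fun x => u t₁ x - v t₁ x) := hdivu.sub hud hvd hdivv
  obtain ⟨Mu, hMu⟩ := huB.isBoundedOn
  obtain ⟨Mv, hMv⟩ := hvB.isBoundedOn
  have hM : ∀ x, ‖u t₁ x - v t₁ x‖ ≤ Mu + Mv := fun x =>
    (norm_sub_le _ _).trans (add_le_add (hMu t₁ ht₁ x) (hMv t₁ ht₁ x))
  have hk : ∀ x, u t₁ x = v t₁ x + (u t₁ 0 - v t₁ 0) := fun x => by
    have h := eq_of_curl_eq_zero_of_isDivFree_of_bounded hd2 hcurl hdiv hM x 0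
    -- `h : u t₁ x - v t₁ x = u t₁ 0 - v t₁ 0`
    rw [← h, add_sub_cancel]
  exact curl_translate_of_slice_eq_add_const u v huB hum husm.continuousOn hvB hvm hvsm.continuousOn ht₁ hk

end OneInstant

end Summit.NavierStokesRegularity.NavierStokesRegularity.Theorems.PoloidalLiouville.Antidynamo

end
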